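import Summits.Ventures.PercRepro.Night2NearFatFair

/-!
# night-2: THE CELLS OF THE NON-SUSPECT FAMILY (gen 40)

`ntpIncome N s d₁ d₂ e₁ e₂` is antitone in the class sizes `e₁, e₂` (`ntpIncome_anti_e`), and the cells used by the
assembly: `N = 10`, `s = 6`: `(0, 0, 8, 0)`, `(5, 0, 8, 0)`, `(5, 5, 8, 0)`, `(6, 0, 7, 0)`; `N = 9`, `s = 5`:
`(0, 0, 6, 6)`, `(4, 0, 6, 6)`, `(4, 4, 6, 6)`; `N = 9`, `s = 6`: `(0, 0, 6, 6)`; `N = 8`, `s = 5`: `(0, 0, 6, 0)` — all `≥ 1`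
(values `1.129`, `1.101`, `1.073`, `1.129`; `1.083`, `1.039`, `1.004`; `1.004`; `1.012`).  Paper: proofs/NIGHT-2-g40.md §5.
-/

namespace PercRepro.Shadow

/-- `suspBound` is monotone in the class sizes. -/
theorem suspBound_mono_e {N i d₁ d₂ e₁ e₂ e₁' e₂' : ℕ} (h₁ : e₁ ≤ e₁') (h₂ : e₂ ≤ e₂') :
    suspBound N i d₁ d₂ e₁ e₂ ≤ suspBound N i d₁ d₂ e₁' e₂' := by
  unfold suspBound
  have := Nat.choose_le_choose i h₁
  have := Nat.choose_le_choose i h₂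
  omega

/-- **`ntpIncome` is antitone in the class sizes.** -/
theorem ntpIncome_anti_e {N s d₁ d₂ e₁ e₂ e₁' e₂' : ℕ} (h₁ : e₁ ≤ e₁') (h₂ : e₂ ≤ e₂') :
    ntpIncome N s d₁ d₂ e₁' e₂' ≤ ntpIncome N s d₁ d₂ e₁ e₂ := by
  unfold ntpIncome
  apply Finset.sum_le_sum
  intro i _
  by_cases hsi : s ≤ i
  · rw [if_pos hsi, if_pos hsi]
    set w : ℚ := (if N ≤ i + 3 then (1 : ℚ) else 11 / 18) with hw
    set c : ℚ := (if N ≤ i + 3 then (0 : ℚ) else 5 * (((N - 2).choose i : ℕ) : ℚ)) with hc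
    have hb : ((suspBound N i d₁ d₂ e₁ e₂ : ℕ) : ℚ) ≤ ((suspBound N i d₁ d₂ e₁' e₂' : ℕ) : ℚ) := by
      exact_mod_cast suspBound_mono_e h₁ h₂
    have hw0 : 0 ≤ w := by
      rw [hw]
      split_ifs <;> norm_num
    have hC : (0 : ℚ) ≤ 3 / (((i + 5).choose 4 : ℕ) : ℚ) := by positivity
    have hmax : max 0 (((N.choose i : ℕ) : ℚ) - c - ((suspBound N i d₁ d₂ e₁' e₂' : ℕ) : ℚ)) ≤
        max 0 (((N.choose i : ℕ) : ℚ) - c - ((suspBound N i d₁ d₂ e₁ e₂ : ℕ) : ℚ)) := by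
      apply max_le_max (le_refl 0)
      linarith
    calc w * max 0 (((N.choose i : ℕ) : ℚ) - c - ((suspBound N i d₁ d₂ e₁' e₂' : ℕ) : ℚ)) * 3 /
          (((i + 5).choose 4 : ℕ) : ℚ)
        = (w * max 0 (((N.choose i : ℕ) : ℚ) - c - ((suspBound N i d₁ d₂ e₁' e₂' : ℕ) : ℚ))) *
            (3 / (((i + 5).choose 4 : ℕ) : ℚ)) := by ring
      _ ≤ (w * max 0 (((N.choose i : ℕ) : ℚ) - c - ((suspBound N i d₁ d₂ e₁ e₂ : ℕ) : ℚ))) *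
            (3 / (((i + 5).choose 4 : ℕ) : ℚ)) := by
          apply mul_le_mul_of_nonneg_right _ hC
          exact mul_le_mul_of_nonneg_left hmax hw0
      _ = w * max 0 (((N.choose i : ℕ) : ℚ) - c - ((suspBound N i d₁ d₂ e₁ e₂ : ℕ) : ℚ)) * 3 /
            (((i + 5).choose 4 : ℕ) : ℚ) := by ring
  · rw [if_neg hsi, if_neg hsi]

/-- `ntpIncome` is symmetric in the two basis-line sizes. -/
theorem ntpIncome_comm (N s d₁ d₂ e₁ e₂ : ℕ) : ntpIncome N s d₁ d₂ e₁ e₂ = ntpIncome N s d₂ d₁ e₁ e₂ := by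
  unfold ntpIncome
  apply Finset.sum_congr rfl
  intro i _
  have h : suspBound N i d₁ d₂ e₁ e₂ = suspBound N i d₂ d₁ e₁ e₂ := by
    unfold suspBound
    ring
  rw [h]

/-- The cell `N = 10`, `s = 6`, `(0, 0, 8, 0)`: `4843/4290`. -/
theorem one_le_ntpIncome_ten_zero_eight : 1 ≤ ntpIncome 10 6 0 0 8 0 := by
  unfold ntpIncome suspBound
  simp only [Finset.sum_range_succ, Finset.sum_range_zero]
  norm_num [Nat.choose, max_def]

/-- The cell `N = 10`, `s = 6`, `(5, 0, 8, 0)`: `28343/25740`. -/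
theorem one_le_ntpIncome_ten_five_eight : 1 ≤ ntpIncome 10 6 5 0 8 0 := by
  unfold ntpIncome suspBound
  simp only [Finset.sum_range_succ, Finset.sum_range_zero]
  norm_num [Nat.choose, max_def]

/-- The cell `N = 10`, `s = 6`, `(5, 5, 8, 0)`: `6907/6435`. -/
theorem one_le_ntpIncome_ten_five_five_eight : 1 ≤ ntpIncome 10 6 5 5 8 0 := by
  unfold ntpIncome suspBound
  simp only [Finset.sum_range_succ, Finset.sum_range_zero]
  norm_num [Nat.choose, max_def]

/-- The cell `N = 10`, `s = 6`, `(6, 0, 7, 0)`: `1321/1170`. -/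
theorem one_le_ntpIncome_ten_six_seven : 1 ≤ ntpIncome 10 6 6 0 7 0 := by
  unfold ntpIncome suspBound
  simp only [Finset.sum_range_succ, Finset.sum_range_zero]
  norm_num [Nat.choose, max_def]

/-- The cell `N = 9`, `s = 5`, `(0, 0, 6, 6)`: `1971/1820`. -/
theorem one_le_ntpIncome_nine_zero_six : 1 ≤ ntpIncome 9 5 0 0 6 6 := by
  unfold ntpIncome suspBound
  simp only [Finset.sum_range_succ, Finset.sum_range_zero]
  norm_num [Nat.choose, max_def]

/-- The cell `N = 9`, `s = 5`, `(4, 0, 6, 6)`: `608/585`. -/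
theorem one_le_ntpIncome_nine_four_six : 1 ≤ ntpIncome 9 5 4 0 6 6 := by
  unfold ntpIncome suspBound
  simp only [Finset.sum_range_succ, Finset.sum_range_zero]
  norm_num [Nat.choose, max_def]

/-- The cell `N = 9`, `s = 5`, `(4, 4, 6, 6)`: `457/455`. -/
theorem one_le_ntpIncome_nine_four_four_six : 1 ≤ ntpIncome 9 5 4 4 6 6 := by
  unfold ntpIncome suspBound
  simp only [Finset.sum_range_succ, Finset.sum_range_zero]
  norm_num [Nat.choose, max_def]

/-- The cell `N = 9`, `s = 6`, `(0, 0, 6, 6)`: `457/455` (the top four levels at `N = 9`). -/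
theorem one_le_ntpIncome_nine_six_six_six : 1 ≤ ntpIncome 9 6 0 0 6 6 := by
  unfold ntpIncome suspBound
  simp only [Finset.sum_range_succ, Finset.sum_range_zero]
  norm_num [Nat.choose, max_def]

/-- The cell `N = 8`, `s = 5`, `(0, 0, 6, 0)`: `30403/30030`. -/
theorem one_le_ntpIncome_eight_zero_six : 1 ≤ ntpIncome 8 5 0 0 6 0 := by
  unfold ntpIncome suspBound
  simp only [Finset.sum_range_succ, Finset.sum_range_zero]
  norm_num [Nat.choose, max_def]

end PercRepro.Shadow
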